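import Mathlib
import Literature.Probability.Process.PointStationaryLaw
import Literature.MathematicalPhysics.StatisticalMechanics.RootEnergy
import Literature.Geometry.DiscreteGeometry.MultiregularPointSystems
import Literature.Geometry.DiscreteGeometry.CrystallographicGroups
import Summits.AtomisticToContinuum.Crystallization.Theses.IsometryAtoms
import Summits.AtomisticToContinuum.Crystallization.Theorems.PalmUnimodularRigidityCruxesToPalmRigidity
import Summits.AtomisticToContinuum.Crystallization.Theorems.PalmUnimodularRigidityMinimiserShellsEnergyFloor
import Summits.AtomisticToContinuum.Crystallization.Theorems.IsometryAtomsMinimisingLawsCohesiveFiniteOrbitsOfChargedAux1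
import Summits.AtomisticToContinuum.Crystallization.Theorems.IsometryAtomsMinimisingLawsCohesiveFiniteOrbitsOfChargedAux2
import Summits.AtomisticToContinuum.Crystallization.Theorems.IsometryAtomsMinimisingLawsCohesiveFiniteOrbitsOfChargedAux3

/-!
# Stub `stub_finiteOrbitsOfCharged` of line `purity_stacking` — crux `IsometryAtoms.MinimisingLawsCohesive`
# (stmt-AtomisticToContinuum-15777)

Helper file for the registered stub `stub_finiteOrbitsOfCharged` (signature registered by `ledger skeleton check` on the
crux item; it must be proved EXACTLY as stated). Lands at
`Summits/AtomisticToContinuum/Crystallization/Theorems/IsometryAtomsMinimisingLawsCohesiveFiniteOrbitsOfCharged.lean`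
with `--supports stmt-AtomisticToContinuum-15777`.
-/

noncomputable section

open MeasureTheory
open scoped ENNReal

namespace Summit.AtomisticToContinuum.Crystallization.Theorems.IsometryAtomsMinimisingLawsCohesive

/-- **Stub `stub_finiteOrbitsOfCharged`** of line `purity_stacking` (crux `IsometryAtoms.MinimisingLawsCohesive`,
stmt-AtomisticToContinuum-15777): **a charged non-slab class has finitely many symmetry orbits.**
Let `P` be a point-stationary probability law on configurations of `ℝ³`, almost surely rooted
`δ`-hard-core, charging the rooted isometry class of `Y` (`P {count|A(Y - q) | A, q ∈ Y} > 0`), and let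
this class contain a rooted `δ`-hard-core configuration `μ` that is not a slab.  Granted the three
neighbour statements (measurability of rooted classes of separated sets, properly discontinuous action
of the symmetry group of a separated non-coplanar set, bounded orders of the finite subgroups of
discontinuous groups of isometries), the symmetry group `{g : ℝ³ ≃ᵃⁱ ℝ³ | g '' Y = Y}` of `Y` has finitely
many orbits on `Y`: there is a finite `S ⊆ ℝ³` met by the orbit of every `x ∈ Y`.

Proof (the route's lever "an atom of a point-stationary law is rigid"): `Y` is `δ`-separated (it is
isometric to the carrier of `μ`) and not coplanar (a coplanar `Y` would make `μ` a slab,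
`coplanar_imp_slab`), so its symmetries act discontinuously and stabilisers have bounded order
`≤ N₀` (`finiteOrbits_exists_card_stab_le`).  Group the charged class by the ORBIT OF THE ROOT: the orbit
classes `K a = {count|A(Y - p) | p ∈ orbit a}` are measurable, pairwise equal or disjoint, and cover the
class, so one of them, `K a₀`, has positive mass.  The Mecke identity for
`g(μ, y) = 1[μ ∈ K a] 1[θ_y μ ∈ K b] 1[‖y‖ ≤ r]` gives `n(a,b,r) P(K a) = n(b,a,r) P(K b)` and, counting
moves, the MASS FORMULA `P(K a) |Stab a| = P(K b) |Stab b| = c > 0` (`finiteOrbits_massFormula`).  Hence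
every orbit class has mass `≥ c / N₀ > 0`; being disjoint events of a probability measure, the orbit
classes — equivalently the orbits — are finitely many (`Measure.finite_const_le_meas_of_disjoint_iUnion`),
and one representative per orbit gives `S`. -/
theorem stub_finiteOrbitsOfCharged :
    (∀ δ : ℝ, 0 < δ → ∀ Y : Set (EuclideanSpace ℝ (Fin 3)),
      (∀ x ∈ Y, ∀ y ∈ Y, x ≠ y → δ ≤ dist x y) → ∀ q : EuclideanSpace ℝ (Fin 3),
      MeasurableSet {μ : MeasureTheory.Measure (EuclideanSpace ℝ (Fin 3)) |
        ∃ A : EuclideanSpace ℝ (Fin 3) →ₗᵢ[ℝ] EuclideanSpace ℝ (Fin 3),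
          μ = (MeasureTheory.Measure.count : MeasureTheory.Measure (EuclideanSpace ℝ (Fin 3))).restrict
            ((fun s => A (s - q)) '' Y)}) →
    (∀ δ : ℝ, 0 < δ → ∀ Y : Set (EuclideanSpace ℝ (Fin 3)),
      (∀ x ∈ Y, ∀ y ∈ Y, x ≠ y → δ ≤ dist x y) →
      (¬ ∃ n : EuclideanSpace ℝ (Fin 3), n ≠ 0 ∧ ∃ c : ℝ, ∀ y ∈ Y, inner ℝ y n = c) →
      ∀ R : ℝ, {g : EuclideanSpace ℝ (Fin 3) ≃ᵃⁱ[ℝ] EuclideanSpace ℝ (Fin 3) |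
        g '' Y = Y ∧ ∃ x : EuclideanSpace ℝ (Fin 3), ‖x‖ ≤ R ∧ ‖g x‖ ≤ R}.Finite) →
    (∀ Γ : Subgroup (EuclideanSpace ℝ (Fin 3) ≃ᵢ EuclideanSpace ℝ (Fin 3)),
      Literature.Geometry.DiscreteGeometry.Crystallographic.IsDiscontinuous Γ →
      (∃ N : ℕ, ∀ H : Subgroup (EuclideanSpace ℝ (Fin 3) ≃ᵢ EuclideanSpace ℝ (Fin 3)),
          H ≤ Γ → Finite H → Nat.card H ≤ N) ∧
      ((∃ v : Fin 3 → EuclideanSpace ℝ (Fin 3),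
          LinearIndependent ℝ v ∧ ∀ i, IsometryEquiv.addRight (v i) ∈ Γ) ∨
       (∃ V : AffineSubspace ℝ (EuclideanSpace ℝ (Fin 3)),
          (V : Set (EuclideanSpace ℝ (Fin 3))).Nonempty ∧ Module.finrank ℝ V.direction ≤ 2 ∧
          ∀ g ∈ Γ, g '' (V : Set (EuclideanSpace ℝ (Fin 3))) = V))) →
    ∀ δ : ℝ, 0 < δ →
      ∀ P : MeasureTheory.Measure (MeasureTheory.Measure (EuclideanSpace ℝ (Fin 3))),
        MeasureTheory.IsProbabilityMeasure P →
        (∀ᵐ μ ∂P, Literature.Probability.Process.IsRootedHardCore δ μ) →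
        Literature.Probability.Process.IsPointStationaryLaw P →
        ∀ Y : Set (EuclideanSpace ℝ (Fin 3)),
          0 < P {ν : MeasureTheory.Measure (EuclideanSpace ℝ (Fin 3)) |
                ∃ A : EuclideanSpace ℝ (Fin 3) →ₗᵢ[ℝ] EuclideanSpace ℝ (Fin 3), ∃ q ∈ Y,
                  ν = (MeasureTheory.Measure.count : MeasureTheory.Measure (EuclideanSpace ℝ (Fin 3))).restrict
                    ((fun s => A (s - q)) '' Y)} →
          ∀ μ : MeasureTheory.Measure (EuclideanSpace ℝ (Fin 3)),
            (∃ A : EuclideanSpace ℝ (Fin 3) →ₗᵢ[ℝ] EuclideanSpace ℝ (Fin 3), ∃ q ∈ Y,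
              μ = (MeasureTheory.Measure.count : MeasureTheory.Measure (EuclideanSpace ℝ (Fin 3))).restrict
                ((fun s => A (s - q)) '' Y)) →
            Literature.Probability.Process.IsRootedHardCore δ μ →
            (¬ ∃ A : EuclideanSpace ℝ (Fin 3) →ₗᵢ[ℝ] EuclideanSpace ℝ (Fin 3), ∃ D : ℝ,
                ∀ y : EuclideanSpace ℝ (Fin 3), μ {y} ≠ 0 → |A y 0| ≤ D) →
            (∃ S : Finset (EuclideanSpace ℝ (Fin 3)), ∀ x ∈ Y,
              ∃ g : EuclideanSpace ℝ (Fin 3) ≃ᵃⁱ[ℝ] EuclideanSpace ℝ (Fin 3),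
                g '' Y = Y ∧ g x ∈ (S : Set (EuclideanSpace ℝ (Fin 3)))) := by
  intro hMC hSD hGS δ hδ P hP hcore hstat Y hpos μ hμcls hμhc hnslab
  haveI := hP
  obtain ⟨A₀, q₀, hq₀, rfl⟩ := hμcls
  -- (0) `Y` is `δ`-separated and not coplanar; its symmetries are locally finite
  have hYsep : ∀ x ∈ Y, ∀ y ∈ Y, x ≠ y → δ ≤ dist x y := FiniteOrbitsOfCharged.sep_of_copy_eq_hardCore hμhc
  have hYnc : ¬ ∃ n : EuclideanSpace ℝ (Fin 3), n ≠ 0 ∧ ∃ c : ℝ, ∀ y ∈ Y, inner ℝ y n = c := by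
    rintro ⟨n, hn, c, hc⟩
    exact hnslab (FiniteOrbitsOfCharged.coplanar_imp_slab hn hc A₀ q₀)
  have hfin : ∀ R : ℝ, {g : EuclideanSpace ℝ (Fin 3) ≃ᵢ EuclideanSpace ℝ (Fin 3) | g '' Y = Y ∧ ∃ x : EuclideanSpace ℝ (Fin 3), ‖x‖ ≤ R ∧ ‖g x‖ ≤ R}.Finite :=
    fun R => FiniteOrbitsOfCharged.finite_iso_of_finite_affine (hSD δ hδ Y hYsep hYnc R)
  -- bounded stabilisers
  obtain ⟨N₀, hN₀⟩ :=
    FiniteOrbitsOfCharged.finiteOrbits_exists_card_stab_le Y (fun Γ hΓ => (hGS Γ hΓ).1) hfin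
  -- measurable rooted classes, countable `Y`
  have hmeas : ∀ q : EuclideanSpace ℝ (Fin 3), MeasurableSet {μ : MeasureTheory.Measure (EuclideanSpace ℝ (Fin 3)) | ∃ A : EuclideanSpace ℝ (Fin 3) →ₗᵢ[ℝ] EuclideanSpace ℝ (Fin 3), μ = (MeasureTheory.Measure.count : MeasureTheory.Measure (EuclideanSpace ℝ (Fin 3))).restrict ((fun s => A (s - q)) '' Y)} := hMC δ hδ Y hYsep
  have hYc : Y.Countable := FiniteOrbitsOfCharged.countable_of_forall_le_dist hδ hYsep
  -- (5) an orbit class of positive mass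
  obtain ⟨a₀, ha₀, hKa₀⟩ : ∃ a₀ ∈ Y, P {ν : MeasureTheory.Measure (EuclideanSpace ℝ (Fin 3)) | ∃ p ∈ {t : EuclideanSpace ℝ (Fin 3) | ∃ g : EuclideanSpace ℝ (Fin 3) ≃ᵢ EuclideanSpace ℝ (Fin 3), g '' Y = Y ∧ g a₀ = t}, ν ∈ {μ : MeasureTheory.Measure (EuclideanSpace ℝ (Fin 3)) | ∃ A : EuclideanSpace ℝ (Fin 3) →ₗᵢ[ℝ] EuclideanSpace ℝ (Fin 3), μ = (MeasureTheory.Measure.count : MeasureTheory.Measure (EuclideanSpace ℝ (Fin 3))).restrict ((fun s => A (s - p)) '' Y)}} ≠ 0 := by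
    by_contra hall
    push Not at hall
    have hsub : {ν : MeasureTheory.Measure (EuclideanSpace ℝ (Fin 3)) | ∃ A : EuclideanSpace ℝ (Fin 3) →ₗᵢ[ℝ] EuclideanSpace ℝ (Fin 3), ∃ q ∈ Y,
        ν = (MeasureTheory.Measure.count : MeasureTheory.Measure (EuclideanSpace ℝ (Fin 3))).restrict ((fun s => A (s - q)) '' Y)} ⊆
        ⋃ a ∈ Y, {ν : MeasureTheory.Measure (EuclideanSpace ℝ (Fin 3)) | ∃ p ∈ {t : EuclideanSpace ℝ (Fin 3) | ∃ g : EuclideanSpace ℝ (Fin 3) ≃ᵢ EuclideanSpace ℝ (Fin 3), g '' Y = Y ∧ g a = t}, ν ∈ {μ : MeasureTheory.Measure (EuclideanSpace ℝ (Fin 3)) | ∃ A : EuclideanSpace ℝ (Fin 3) →ₗᵢ[ℝ] EuclideanSpace ℝ (Fin 3), μ = (MeasureTheory.Measure.count : MeasureTheory.Measure (EuclideanSpace ℝ (Fin 3))).restrict ((fun s => A (s - p)) '' Y)}} := by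
      rintro ν ⟨A, q, hq, rfl⟩
      exact Set.mem_biUnion hq ⟨q, FiniteOrbitsOfCharged.mem_orbit_self Y q, A, rfl⟩
    have h0 : P (⋃ a ∈ Y, {ν : MeasureTheory.Measure (EuclideanSpace ℝ (Fin 3)) | ∃ p ∈ {t : EuclideanSpace ℝ (Fin 3) | ∃ g : EuclideanSpace ℝ (Fin 3) ≃ᵢ EuclideanSpace ℝ (Fin 3), g '' Y = Y ∧ g a = t}, ν ∈ {μ : MeasureTheory.Measure (EuclideanSpace ℝ (Fin 3)) | ∃ A : EuclideanSpace ℝ (Fin 3) →ₗᵢ[ℝ] EuclideanSpace ℝ (Fin 3), μ = (MeasureTheory.Measure.count : MeasureTheory.Measure (EuclideanSpace ℝ (Fin 3))).restrict ((fun s => A (s - p)) '' Y)}}) = 0 := (measure_biUnion_null_iff hYc).2 hall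
    exact (lt_irrefl (0 : ℝ≥0∞)) (hpos.trans_le ((measure_mono hsub).trans h0.le))
  -- (4) the mass formula and the stabiliser bounds
  have hmass : ∀ b ∈ Y, P {ν : MeasureTheory.Measure (EuclideanSpace ℝ (Fin 3)) | ∃ p ∈ {t : EuclideanSpace ℝ (Fin 3) | ∃ g : EuclideanSpace ℝ (Fin 3) ≃ᵢ EuclideanSpace ℝ (Fin 3), g '' Y = Y ∧ g a₀ = t}, ν ∈ {μ : MeasureTheory.Measure (EuclideanSpace ℝ (Fin 3)) | ∃ A : EuclideanSpace ℝ (Fin 3) →ₗᵢ[ℝ] EuclideanSpace ℝ (Fin 3), μ = (MeasureTheory.Measure.count : MeasureTheory.Measure (EuclideanSpace ℝ (Fin 3))).restrict ((fun s => A (s - p)) '' Y)}} * (Nat.card {g : EuclideanSpace ℝ (Fin 3) ≃ᵢ EuclideanSpace ℝ (Fin 3) // g '' Y = Y ∧ g a₀ = a₀} : ℝ≥0∞) =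
      P {ν : MeasureTheory.Measure (EuclideanSpace ℝ (Fin 3)) | ∃ p ∈ {t : EuclideanSpace ℝ (Fin 3) | ∃ g : EuclideanSpace ℝ (Fin 3) ≃ᵢ EuclideanSpace ℝ (Fin 3), g '' Y = Y ∧ g b = t}, ν ∈ {μ : MeasureTheory.Measure (EuclideanSpace ℝ (Fin 3)) | ∃ A : EuclideanSpace ℝ (Fin 3) →ₗᵢ[ℝ] EuclideanSpace ℝ (Fin 3), μ = (MeasureTheory.Measure.count : MeasureTheory.Measure (EuclideanSpace ℝ (Fin 3))).restrict ((fun s => A (s - p)) '' Y)}} * (Nat.card {g : EuclideanSpace ℝ (Fin 3) ≃ᵢ EuclideanSpace ℝ (Fin 3) // g '' Y = Y ∧ g b = b} : ℝ≥0∞) := fun b hb =>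
    FiniteOrbitsOfCharged.measure_klass_mul_card_stab_eq hδ hYsep hmeas hfin hcore hstat ha₀ hb
  have hs_pos : 0 < Nat.card {g : EuclideanSpace ℝ (Fin 3) ≃ᵢ EuclideanSpace ℝ (Fin 3) // g '' Y = Y ∧ g a₀ = a₀} := by
    haveI : Finite {g : EuclideanSpace ℝ (Fin 3) ≃ᵢ EuclideanSpace ℝ (Fin 3) // g '' Y = Y ∧ g a₀ = a₀} := (FiniteOrbitsOfCharged.finite_stab hfin a₀).to_subtype
    haveI : Nonempty {g : EuclideanSpace ℝ (Fin 3) ≃ᵢ EuclideanSpace ℝ (Fin 3) // g '' Y = Y ∧ g a₀ = a₀} :=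
      ⟨⟨1, by rw [IsometryEquiv.coe_one, Set.image_id], rfl⟩⟩
    exact Nat.card_pos
  have hc0 : P {ν : MeasureTheory.Measure (EuclideanSpace ℝ (Fin 3)) | ∃ p ∈ {t : EuclideanSpace ℝ (Fin 3) | ∃ g : EuclideanSpace ℝ (Fin 3) ≃ᵢ EuclideanSpace ℝ (Fin 3), g '' Y = Y ∧ g a₀ = t}, ν ∈ {μ : MeasureTheory.Measure (EuclideanSpace ℝ (Fin 3)) | ∃ A : EuclideanSpace ℝ (Fin 3) →ₗᵢ[ℝ] EuclideanSpace ℝ (Fin 3), μ = (MeasureTheory.Measure.count : MeasureTheory.Measure (EuclideanSpace ℝ (Fin 3))).restrict ((fun s => A (s - p)) '' Y)}} * (Nat.card {g : EuclideanSpace ℝ (Fin 3) ≃ᵢ EuclideanSpace ℝ (Fin 3) // g '' Y = Y ∧ g a₀ = a₀} : ℝ≥0∞) ≠ 0 :=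
    mul_ne_zero hKa₀ (by exact_mod_cast hs_pos.ne')
  have hε : 0 < P {ν : MeasureTheory.Measure (EuclideanSpace ℝ (Fin 3)) | ∃ p ∈ {t : EuclideanSpace ℝ (Fin 3) | ∃ g : EuclideanSpace ℝ (Fin 3) ≃ᵢ EuclideanSpace ℝ (Fin 3), g '' Y = Y ∧ g a₀ = t}, ν ∈ {μ : MeasureTheory.Measure (EuclideanSpace ℝ (Fin 3)) | ∃ A : EuclideanSpace ℝ (Fin 3) →ₗᵢ[ℝ] EuclideanSpace ℝ (Fin 3), μ = (MeasureTheory.Measure.count : MeasureTheory.Measure (EuclideanSpace ℝ (Fin 3))).restrict ((fun s => A (s - p)) '' Y)}} * (Nat.card {g : EuclideanSpace ℝ (Fin 3) ≃ᵢ EuclideanSpace ℝ (Fin 3) // g '' Y = Y ∧ g a₀ = a₀} : ℝ≥0∞) / N₀ :=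
    ENNReal.div_pos_iff.2 ⟨hc0, ENNReal.natCast_ne_top _⟩
  have hlow : ∀ b ∈ Y, P {ν : MeasureTheory.Measure (EuclideanSpace ℝ (Fin 3)) | ∃ p ∈ {t : EuclideanSpace ℝ (Fin 3) | ∃ g : EuclideanSpace ℝ (Fin 3) ≃ᵢ EuclideanSpace ℝ (Fin 3), g '' Y = Y ∧ g a₀ = t}, ν ∈ {μ : MeasureTheory.Measure (EuclideanSpace ℝ (Fin 3)) | ∃ A : EuclideanSpace ℝ (Fin 3) →ₗᵢ[ℝ] EuclideanSpace ℝ (Fin 3), μ = (MeasureTheory.Measure.count : MeasureTheory.Measure (EuclideanSpace ℝ (Fin 3))).restrict ((fun s => A (s - p)) '' Y)}} * (Nat.card {g : EuclideanSpace ℝ (Fin 3) ≃ᵢ EuclideanSpace ℝ (Fin 3) // g '' Y = Y ∧ g a₀ = a₀} : ℝ≥0∞) / N₀ ≤ P {ν : MeasureTheory.Measure (EuclideanSpace ℝ (Fin 3)) | ∃ p ∈ {t : EuclideanSpace ℝ (Fin 3) | ∃ g : EuclideanSpace ℝ (Fin 3) ≃ᵢ EuclideanSpace ℝ (Fin 3),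 g '' Y = Y ∧ g b = t}, ν ∈ {μ : MeasureTheory.Measure (EuclideanSpace ℝ (Fin 3)) | ∃ A : EuclideanSpace ℝ (Fin 3) →ₗᵢ[ℝ] EuclideanSpace ℝ (Fin 3), μ = (MeasureTheory.Measure.count : MeasureTheory.Measure (EuclideanSpace ℝ (Fin 3))).restrict ((fun s => A (s - p)) '' Y)}} := by
    intro b hb
    apply ENNReal.div_le_of_le_mul
    rw [hmass b hb]
    gcongr
    exact_mod_cast hN₀ b
  -- (7) the set of orbits of points of `Y` is finite
  have hOfin : ((fun x : EuclideanSpace ℝ (Fin 3) => {t : EuclideanSpace ℝ (Fin 3) | ∃ g : EuclideanSpace ℝ (Fin 3) ≃ᵢ EuclideanSpace ℝ (Fin 3), g '' Y = Y ∧ g x = t}) '' Y).Finite := by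
    have key := MeasureTheory.Measure.finite_const_le_meas_of_disjoint_iUnion P hε
      (As := fun o : ↥((fun x : EuclideanSpace ℝ (Fin 3) => {t : EuclideanSpace ℝ (Fin 3) | ∃ g : EuclideanSpace ℝ (Fin 3) ≃ᵢ EuclideanSpace ℝ (Fin 3), g '' Y = Y ∧ g x = t}) '' Y) =>
        {ν : MeasureTheory.Measure (EuclideanSpace ℝ (Fin 3)) | ∃ p ∈ (o : Set (EuclideanSpace ℝ (Fin 3))), ν ∈ {μ : MeasureTheory.Measure (EuclideanSpace ℝ (Fin 3)) | ∃ A : EuclideanSpace ℝ (Fin 3) →ₗᵢ[ℝ] EuclideanSpace ℝ (Fin 3), μ = (MeasureTheory.Measure.count : MeasureTheory.Measure (EuclideanSpace ℝ (Fin 3))).restrict ((fun s => A (s - p)) '' Y)}}) ?_ ?_ (measure_ne_top P _)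
    · have huniv : {i : ↥((fun x : EuclideanSpace ℝ (Fin 3) => {t : EuclideanSpace ℝ (Fin 3) | ∃ g : EuclideanSpace ℝ (Fin 3) ≃ᵢ EuclideanSpace ℝ (Fin 3), g '' Y = Y ∧ g x = t}) '' Y) |
          P {ν : MeasureTheory.Measure (EuclideanSpace ℝ (Fin 3)) | ∃ p ∈ {t : EuclideanSpace ℝ (Fin 3) | ∃ g : EuclideanSpace ℝ (Fin 3) ≃ᵢ EuclideanSpace ℝ (Fin 3), g '' Y = Y ∧ g a₀ = t}, ν ∈ {μ : MeasureTheory.Measure (EuclideanSpace ℝ (Fin 3)) | ∃ A : EuclideanSpace ℝ (Fin 3) →ₗᵢ[ℝ] EuclideanSpace ℝ (Fin 3), μ = (MeasureTheory.Measure.count : MeasureTheory.Measure (EuclideanSpace ℝ (Fin 3))).restrict ((fun s => A (s - p)) '' Y)}} * (Nat.card {g : EuclideanSpace ℝ (Fin 3) ≃ᵢ EuclideanSpace ℝ (Fin 3) // g '' Y = Y ∧ g a₀ = a₀} : ℝ≥0∞) / N₀ ≤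
            P {ν : MeasureTheory.Measure (EuclideanSpace ℝ (Fin 3)) | ∃ p ∈ (i : Set (EuclideanSpace ℝ (Fin 3))), ν ∈ {μ : MeasureTheory.Measure (EuclideanSpace ℝ (Fin 3)) | ∃ A : EuclideanSpace ℝ (Fin 3) →ₗᵢ[ℝ] EuclideanSpace ℝ (Fin 3), μ = (MeasureTheory.Measure.count : MeasureTheory.Measure (EuclideanSpace ℝ (Fin 3))).restrict ((fun s => A (s - p)) '' Y)}}} = Set.univ := by
        refine Set.eq_univ_of_forall fun i => ?_
        obtain ⟨o, x, hx, rfl⟩ := i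
        exact hlow x hx
      rw [huniv] at key
      exact Set.finite_coe_iff.1 (Set.finite_univ_iff.1 key)
    · intro i
      obtain ⟨o, x, hx, rfl⟩ := i
      exact FiniteOrbitsOfCharged.measurableSet_klass hYc hmeas hx
    · intro i j hij
      obtain ⟨o, x, hx, rfl⟩ := i
      obtain ⟨o', x', hx', rfl⟩ := j
      have hx'x : x' ∉ {t : EuclideanSpace ℝ (Fin 3) | ∃ g : EuclideanSpace ℝ (Fin 3) ≃ᵢ EuclideanSpace ℝ (Fin 3), g '' Y = Y ∧ g x = t} := by
        intro h
        exact hij (Subtype.ext (FiniteOrbitsOfCharged.orbit_eq_of_mem h).symm)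
      exact FiniteOrbitsOfCharged.disjoint_klass hx'x
  -- one representative per orbit
  have hne : ∀ o ∈ (fun x : EuclideanSpace ℝ (Fin 3) => {t : EuclideanSpace ℝ (Fin 3) | ∃ g : EuclideanSpace ℝ (Fin 3) ≃ᵢ EuclideanSpace ℝ (Fin 3), g '' Y = Y ∧ g x = t}) '' Y, ∃ z : EuclideanSpace ℝ (Fin 3), z ∈ o := by
    rintro _ ⟨x, _, rfl⟩
    exact ⟨x, FiniteOrbitsOfCharged.mem_orbit_self Y x⟩
  choose! rep hrep using hne
  refine ⟨(hOfin.image rep).toFinset, fun x hx => ?_⟩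
  have ho : {t : EuclideanSpace ℝ (Fin 3) | ∃ g : EuclideanSpace ℝ (Fin 3) ≃ᵢ EuclideanSpace ℝ (Fin 3), g '' Y = Y ∧ g x = t} ∈ (fun x : EuclideanSpace ℝ (Fin 3) => {t : EuclideanSpace ℝ (Fin 3) | ∃ g : EuclideanSpace ℝ (Fin 3) ≃ᵢ EuclideanSpace ℝ (Fin 3), g '' Y = Y ∧ g x = t}) '' Y := Set.mem_image_of_mem _ hx
  obtain ⟨g, hgY, hgx⟩ := hrep _ ho
  refine ⟨g.toRealAffineIsometryEquiv, ?_, ?_⟩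
  · rw [IsometryEquiv.coeFn_toRealAffineIsometryEquiv]
    exact hgY
  · rw [IsometryEquiv.coeFn_toRealAffineIsometryEquiv, Set.Finite.coe_toFinset, hgx]
    exact Set.mem_image_of_mem rep ho

end Summit.AtomisticToContinuum.Crystallization.Theorems.IsometryAtomsMinimisingLawsCohesive

end
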